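import Literature.MathematicalPhysics.QuantumFieldTheory.Federbush1986.NonAbelianDualityPlaquetteCascade

/-!
# `Federbush1986.NonAbelianDualityEdgeSizes` — [Federbush1987PhaseCellVI] THEOREM 2 p. 20, ingredient: the EDGE VARIABLES OF
# THE LOGARITHMIC CASCADE AGAINST THE POTENTIAL, `|A(e; s) − ℓ_s A_μ(x_e)| ≤ K(B₂′ + B₁′²)ℓ_s²`, with thresholds from global
# caps and constants HOMOGENEOUS in the potential's own bounds (theorems only)

statement-level skeleton of published theorems with citation tags; proofs where landed; nothing here is a claim about the Yang–Mills mass gap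

CITATION HEADER.  P. Federbush, *A phase cell approach to Yang–Mills theory. VI. Non-abelian lattice-continuum duality*,
Ann. Inst. H. Poincaré (Physique théorique) **47** (1987) 17–23, Numdam `AIHPA_1987__47_1_17_0` [Federbush1987PhaseCellVI]
(cell paper F6; pp. 18–23 READ AS IMAGES `run/shared/lean/pub/lit-balaban/lit-balaban-r19/renders/fedVI/fedVI-p003…p008.png`).
P. Federbush, *… I. Modes, lattice-continuum duality*, Commun. Math. Phys. **107** (1986) 319–329 [Federbush1986PhaseCellI],
(2.10) p. 326.  Unit `lit-balaban-r19` gen 5 (reader/typer r19; owner of the F6 statement file); SKELETON row **F6.Thm2**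
(statement of record `BlockSpinSystem.Theorem2Oriented`, `NonAbelianDuality.lean` v5) — INGREDIENT (g) of its Phase-2 proof
(plan HOME/INBOX r19 → r17 2026-08-21; split agreed with the F-fold owner r17 gen 4).  Inputs BY NAME: `topStep` and its §0–§4
lemmas (`NonAbelianDualityTopStep`, this unit gen 3 — re-run here with PARAMETRISED bounds, `topStep_of_le`), `eq31`
(`NonAbelianDualityEq31Proof`, unit r17), `iterBlockSpinLog_top/_self`, `latLen_*` (`NonAbelianDualityEq26Proof`, unit r17).
HOME `run/shared/lean/pub/lit-balaban/`.

WHAT IS PRINTED.  VI p. 22–23: «(28) follows from (25) with the input of (7) and (11) along with the uniform bounds on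
|DA_μ(x)| and |A_μ(x)|», (29)–(31), and p. 23 «the A(e, r₀) converge with better bounds as r₀ → ∞»; I (2.10) p. 326
«|A(e) − ℓA_μ(x)| ≤ cℓ²|DA|» (abelian).  Theorem 2 p. 20 is stated for potentials with `|x|^{2+ε}|A_μ(x)| < c`,
`|x|^{2+ε}|DA_μ(x)| < c`: to sum the plaquette expansion over the infinitely many plaquettes of one level, every error
constant must be PROPORTIONAL to the local size of the field — hence the two-tier form below (thresholds from global caps
`B₁, B₂`; bounds linear in the potential's own `B₂′` and `B₁′²`).

THE MATHEMATICS.  (§1) The top step with explicit constant: `|BS^log_r(λ_{r+1})(e) − λ_r(e)| ≤ (37B₂′ + KB₁′²)ℓ_r²` for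
`r ≥ r̄(B₁)`, `K = max(c₀,0)/4` (`c₀` the constant of (21)) — the proof of `topStep` verbatim with the bounds of the potential
kept symbolic and the threshold taken from the cap.  (§2) Telescoping over the runs: `A(e; s)[r] − λ_s(e) = Σ_{m<r−s}
(X^{(s)}[BS^log λ_{s+m+1}] − X^{(s)}[λ_{s+m}])`, each term bounded by (31) with `a = B₁ + c_top + 2`, `b = (c_top′ + η)ℓ_{s+m}/a`
(`η → 0`): `≤ 2C″c_top′ℓ_sℓ_{s+m}`, `C″ = max(c, 0, 1)`; summing the geometric series `|A(e; s)[r] − λ_s(e)| ≤ 4C″c_top′ℓ_s²`,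
`c_top′ = 37B₂′ + KB₁′² ≤ max(37, K)(B₂′ + B₁′²)`.  (§3) `|λ_s(e) − ℓ_sA_μ(x_e)| ≤ 2B₂′ℓ_s²` (C¹ Taylor along the edge), so
`|A(e; s)[r] − ℓ_sA_μ(x_e)| ≤ (K₃ + 2)(B₂′ + B₁′²)ℓ_s²` uniformly in the run length `r ≥ s`.

WHAT THIS MODULE PROVES (theorems only; no `def`, no `Prop` definition, no named fact; axioms standard).  §1 **`topStep_of_le`**;
§2 **`norm_iterBlockSpinLog_logData_sub_logData_le_of_le`**; §3 `norm_logData_sub_smul_le`,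
**`norm_iterBlockSpinLog_logData_sub_smul_le_of_le`**.
-/

namespace Literature.MathematicalPhysics.QuantumFieldTheory.Federbush1986

noncomputable section

open Filter Metric Set
open scoped Topology BigOperators

namespace BlockSpinSystem

variable (S : BlockSpinSystem)

/-- Removing an auxiliary `η`: if `x ≤ c(B + η)` for every `0 < η < 1` (with `c ≥ 0`), then `x ≤ cB`. [folklore] -/
private theorem le_of_forall_eta' {x c B : ℝ} (hc : 0 ≤ c) (h : ∀ η : ℝ, 0 < η → η < 1 → x ≤ c * (B + η)) :
    x ≤ c * B := by
  refine le_of_forall_pos_le_add fun ε hε => ?_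
  have hη : 0 < min (1 / 2 : ℝ) (ε / (c + 1)) := lt_min (by norm_num) (by positivity)
  have hη1 : min (1 / 2 : ℝ) (ε / (c + 1)) < 1 := (min_le_left _ _).trans_lt (by norm_num)
  have := h _ hη hη1
  have hcη : c * min (1 / 2 : ℝ) (ε / (c + 1)) ≤ ε := by
    calc c * min (1 / 2 : ℝ) (ε / (c + 1)) ≤ c * (ε / (c + 1)) := mul_le_mul_of_nonneg_left (min_le_right _ _) hc
      _ ≤ (c + 1) * (ε / (c + 1)) := mul_le_mul_of_nonneg_right (by linarith) (by positivity)
      _ = ε := by field_simp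
  linarith [mul_add c B (min (1 / 2 : ℝ) (ε / (c + 1)))]

/-! ## §1 The top step with the potential's bounds kept symbolic -/

/-- **The top-step estimate with explicit, homogeneous constant** (the proof of `topStep` re-run with parametrised bounds):
there is a scheme constant `K ≥ 0` (`= max(c₀, 0)/4`, `c₀` the constant of (21)) and, for every cap `B₁`, a level `r̄`
(`ℓ_{r̄}(B₁ + 1) < ε″`) such that for every `C¹` potential with `|A| ≤ B₁′ ≤ B₁`, `|DA| ≤ B₂′` and every `r ≥ r̄`:
`|BS^log_r(λ_{r+1})(e) − λ_r(e)| ≤ (37B₂′ + KB₁′²)·ℓ_r²`. [cite: Federbush1987PhaseCellVI, (7) p. 19, (18), (21) p. 21, (28)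
p. 22; Federbush1986PhaseCellI, (2.10) p. 326] -/
theorem topStep_of_le (hFS : S.IsFederbushSystem) :
    ∃ K : ℝ, 0 ≤ K ∧ ∀ B₁ : ℝ, 0 ≤ B₁ → ∃ rbar : ℕ, ∀ (A : S.Potential), ContDiff ℝ 1 A →
      ∀ (B₁' B₂' : ℝ), (∀ x μ, ‖A x μ‖ ≤ B₁') → (∀ x μ ν, ‖fderiv ℝ (fun y => A y μ) x (unitVec ν)‖ ≤ B₂') →
        B₁' ≤ B₁ → ∀ r₀, rbar ≤ r₀ → ∀ e : Edge r₀,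
          ‖S.blockSpinLog r₀ (S.logData A (r₀ + 1)) e - S.logData A r₀ e‖ ≤
            (37 * B₂' + K * B₁' ^ 2) * latLen r₀ ^ 2 := by
  obtain ⟨c₀, ε'', hε'', H21⟩ := hFS.estimates
  refine ⟨max c₀ 0 / 4, by positivity, fun B₁ hB₁ => ?_⟩
  -- threshold: ℓ_{rbar}·(B₁ + 1) < ε″
  obtain ⟨rbar, hrbar⟩ := exists_pow_lt_of_lt_one (div_pos hε'' (by linarith : (0 : ℝ) < B₁ + 1))
    (by norm_num : (1 / 2 : ℝ) < 1)
  have hrbar' : latLen rbar < ε'' / (B₁ + 1) := by simpa [latLen, one_div, inv_pow] using hrbar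
  refine ⟨rbar, fun A hA B₁' B₂' hB₁' hB₂' hcap r hr e => ?_⟩
  have hB₁'0 : 0 ≤ B₁' := (norm_nonneg _).trans (hB₁' 0 0)
  have hB₂'0 : 0 ≤ B₂' := (norm_nonneg _).trans (hB₂' 0 0 0)
  obtain ⟨b, μ⟩ := e
  -- names
  set ℓ' : ℝ := latLen (r + 1) with hℓ'
  have hℓ'pos : 0 < ℓ' := latLen_pos _
  have hℓ : latLen r = 2 * ℓ' := by rw [hℓ', latLen_succ]; ring
  set q : E4 := (⟨b, μ⟩ : Edge r).src with hq
  set a : Edge (r + 1) → S.𝔤 := S.logData A (r + 1) with ha_def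
  set X : Fin S.M → S.𝔤 := fun α => a (S.vars r ⟨b, μ⟩ α) with hX
  -- (18): F = F^L + F′ at the block variables
  have hsplit : S.blockSpinLog r a ⟨b, μ⟩ = S.FL X + S.Fprime X := by
    simp [blockSpinLog, Fprime, hX]
  -- the fine data are small: ‖a e'‖ ≤ ℓ′B₁′
  have ha : ∀ e', ‖a e'‖ ≤ ℓ' * B₁' := fun e' => S.norm_logData_le A hB₁' e'
  have hXn : ‖X‖ ≤ ℓ' * B₁' := (pi_norm_le_iff_of_nonneg (by positivity)).mpr fun α => ha _
  have hXε : ‖X‖ < ε'' := by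
    have h1 : ℓ' ≤ latLen rbar := by
      rw [hℓ']
      rcases eq_or_lt_of_le (show rbar ≤ r + 1 by omega) with h | h
      · rw [h]
      · exact (latLen_lt_of_lt h).le
    have h2 : ℓ' * (B₁ + 1) < ε'' := by
      have := (lt_div_iff₀ (by linarith : (0 : ℝ) < B₁ + 1)).mp (h1.trans_lt hrbar')
      nlinarith
    have h3 : ℓ' * B₁' ≤ ℓ' * B₁ := mul_le_mul_of_nonneg_left hcap hℓ'pos.le
    nlinarith
  -- (21): the F′ part
  have hF' : ‖S.Fprime X‖ ≤ max c₀ 0 / 4 * B₁' ^ 2 * latLen r ^ 2 := by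
    have h1 := (H21 X hXε).1
    calc ‖S.Fprime X‖ ≤ c₀ * ‖X‖ ^ 2 := h1
      _ ≤ max c₀ 0 * ‖X‖ ^ 2 := mul_le_mul_of_nonneg_right (le_max_left _ _) (sq_nonneg _)
      _ ≤ max c₀ 0 * (ℓ' * B₁') ^ 2 :=
          mul_le_mul_of_nonneg_left (pow_le_pow_left₀ (norm_nonneg _) hXn 2) (le_max_right _ _)
      _ = max c₀ 0 / 4 * B₁' ^ 2 * latLen r ^ 2 := by rw [hℓ]; ring
  -- the F^L part, written as the average over the 2⁴ path words
  have hFL : S.FL X = (1 / 16 : ℝ) • ∑ x : Fin 16, wordSum a (canonWord r ⟨b, μ⟩ x) := by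
    rw [hX, S.FL_vars_eq_avStep hFS r a ⟨b, μ⟩, AxialTreeV.avStep]
    congr 1
    rw [← AxialTreeV.sum_bits_eq (fun δ => AxialTreeV.pathSum (AxialTreeV.toCfg a) b μ δ)]
    refine Finset.sum_congr rfl fun x _ => ?_
    rw [AxialTreeV.wordSum_canonWord]
  -- «for constant A(x) the two assignments agree»: the word sum of the constant field ℓ′A(q) is ℓA(q)_μ
  have hconst : ∀ x : Fin 16,
      wordSum (fun e' : Edge (r + 1) => ℓ' • A q e'.dir) (canonWord r ⟨b, μ⟩ x) = latLen r • A q μ := by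
    intro x
    rw [AxialTreeV.wordSum_canonWord]
    show AxialTreeV.pathSum (fun _ k => ℓ' • A q k) b μ (bits x) = latLen r • A q μ
    rw [pathSum_const, hℓ, ← two_smul ℝ, smul_smul]
  -- Lipschitz bound of the potential
  have hLip : ∀ (d : Fin 4) (y : E4), ‖A y d - A q d‖ ≤ 2 * B₂' * ‖y - q‖ :=
    fun d y => S.norm_sub_le_of_fderiv_le A hA hB₂' d q y
  -- each fine edge of Γ_x: ∫_{e'} A within 14B₂′ℓ′² of ℓ′A(q)_{dir}
  have hfine : ∀ x (l : Edge (r + 1) × Bool), l ∈ canonWord r ⟨b, μ⟩ x →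
      ‖a l.1 - ℓ' • A q l.1.dir‖ ≤ ℓ' * (14 * B₂' * ℓ') := by
    intro x l hl
    have hbase := mem_canonWord_base b μ x l hl
    obtain ⟨w, hw, hwb⟩ : ∃ w : Fin 4 → ℤ, (∀ k, l.1.base k = 2 * b k + w k) ∧ ∀ k, 0 ≤ w k ∧ w k ≤ 3 :=
      ⟨fun k => l.1.base k - 2 * b k, fun k => by ring, fun k => by
        have h := hbase k; exact ⟨by dsimp only; omega, by dsimp only; omega⟩⟩
    have hsrc : l.1.src - q = ℓ' • mkPt (fun k => (w k : ℝ)) := src_fine_sub_src b μ l.1 w hw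
    have hw6 : ‖mkPt (fun k => (w k : ℝ))‖ ≤ 6 :=
      norm_mkPt_le_of_abs_le _ fun k => by
        have h1 : (0 : ℝ) ≤ (w k : ℝ) := by exact_mod_cast (hwb k).1
        have h2 : (w k : ℝ) ≤ 3 := by exact_mod_cast (hwb k).2
        exact abs_le.mpr ⟨by linarith, h2⟩
    refine S.norm_lineInt_sub_smul_le A hA l.1.src l.1.dir (A q l.1.dir) hℓ'pos.le fun t ht => ?_
    have hdist : ‖l.1.src + t • unitVec l.1.dir - q‖ ≤ 7 * ℓ' := by
      have h1 : l.1.src + t • unitVec l.1.dir - q = ℓ' • mkPt (fun k => (w k : ℝ)) + t • unitVec l.1.dir := by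
        rw [← hsrc]; abel
      rw [h1]
      have hu : ‖unitVec l.1.dir‖ = 1 := by simp [unitVec]
      calc ‖ℓ' • mkPt (fun k => (w k : ℝ)) + t • unitVec l.1.dir‖
          ≤ ‖ℓ' • mkPt (fun k => (w k : ℝ))‖ + ‖t • unitVec l.1.dir‖ := norm_add_le _ _
        _ = ℓ' * ‖mkPt (fun k => (w k : ℝ))‖ + t := by
            rw [norm_smul, norm_smul, hu, Real.norm_of_nonneg hℓ'pos.le, Real.norm_of_nonneg ht.1, mul_one]
        _ ≤ ℓ' * 6 + ℓ' := add_le_add (mul_le_mul_of_nonneg_left hw6 hℓ'pos.le) ht.2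
        _ = 7 * ℓ' := by ring
    calc ‖A (l.1.src + t • unitVec l.1.dir) l.1.dir - A q l.1.dir‖
        ≤ 2 * B₂' * ‖l.1.src + t • unitVec l.1.dir - q‖ := hLip _ _
      _ ≤ 2 * B₂' * (7 * ℓ') := mul_le_mul_of_nonneg_left hdist (by positivity)
      _ = 14 * B₂' * ℓ' := by ring
  -- the coarse edge: ∫_e A within 8B₂′ℓ′² of ℓA(q)_μ
  have hcoarse : ‖(∫ t in (0 : ℝ)..latLen r, A (q + t • unitVec μ) μ) - latLen r • A q μ‖ ≤ 8 * B₂' * ℓ' ^ 2 := by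
    have h := S.norm_lineInt_sub_smul_le A hA q μ (A q μ) (latLen_pos r).le (K := 2 * B₂' * latLen r)
      fun t ht => by
        calc ‖A (q + t • unitVec μ) μ - A q μ‖ ≤ 2 * B₂' * ‖q + t • unitVec μ - q‖ := hLip _ _
          _ ≤ 2 * B₂' * latLen r := by
              apply mul_le_mul_of_nonneg_left _ (by positivity)
              have hu : ‖unitVec μ‖ = 1 := by simp [unitVec]
              rw [add_sub_cancel_left, norm_smul, hu, mul_one, Real.norm_of_nonneg ht.1]
              exact ht.2
    calc _ ≤ latLen r * (2 * B₂' * latLen r) := h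
      _ = 8 * B₂' * ℓ' ^ 2 := by rw [hℓ]; ring
  -- the word sums of the error configuration
  have hword : ∀ x : Fin 16,
      ‖wordSum a (canonWord r ⟨b, μ⟩ x) - latLen r • A q μ‖ ≤ 140 * B₂' * ℓ' ^ 2 := by
    intro x
    rw [← hconst x, ← wordSum_sub]
    refine (norm_wordSum_le _ _ (fun l hl => hfine x l hl)).trans ?_
    have hlen : ((canonWord r ⟨b, μ⟩ x).length : ℝ) ≤ 10 := by exact_mod_cast length_canonWord_le _ _
    have h0 : 0 ≤ ℓ' * (14 * B₂' * ℓ') := by positivity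
    nlinarith
  -- assembling the F^L part
  have hFLerr : ‖S.FL X - ∫ t in (0 : ℝ)..latLen r, A (q + t • unitVec μ) μ‖ ≤ 37 * B₂' * latLen r ^ 2 := by
    have h16 : (1 / 16 : ℝ) • ∑ x : Fin 16, (wordSum a (canonWord r ⟨b, μ⟩ x) - latLen r • A q μ)
        = S.FL X - latLen r • A q μ := by
      rw [hFL, Finset.sum_sub_distrib, smul_sub, Finset.sum_const, Finset.card_univ, Fintype.card_fin,
        ← Nat.cast_smul_eq_nsmul ℝ, smul_smul]
      norm_num
    have h1 : ‖S.FL X - latLen r • A q μ‖ ≤ 140 * B₂' * ℓ' ^ 2 := by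
      rw [← h16, norm_smul, Real.norm_of_nonneg (by norm_num : (0 : ℝ) ≤ 1 / 16)]
      calc (1 / 16 : ℝ) * ‖∑ x : Fin 16, (wordSum a (canonWord r ⟨b, μ⟩ x) - latLen r • A q μ)‖
          ≤ (1 / 16 : ℝ) * ∑ x : Fin 16, ‖wordSum a (canonWord r ⟨b, μ⟩ x) - latLen r • A q μ‖ :=
            mul_le_mul_of_nonneg_left (norm_sum_le _ _) (by norm_num)
        _ ≤ (1 / 16 : ℝ) * ∑ _x : Fin 16, 140 * B₂' * ℓ' ^ 2 :=
            mul_le_mul_of_nonneg_left (Finset.sum_le_sum fun x _ => hword x) (by norm_num)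
        _ = 140 * B₂' * ℓ' ^ 2 := by
            rw [Finset.sum_const, Finset.card_univ, Fintype.card_fin, nsmul_eq_mul]
            ring
    calc ‖S.FL X - ∫ t in (0 : ℝ)..latLen r, A (q + t • unitVec μ) μ‖
        ≤ ‖S.FL X - latLen r • A q μ‖ + ‖latLen r • A q μ - ∫ t in (0 : ℝ)..latLen r, A (q + t • unitVec μ) μ‖ :=
          norm_sub_le_norm_sub_add_norm_sub _ _ _
      _ ≤ 140 * B₂' * ℓ' ^ 2 + 8 * B₂' * ℓ' ^ 2 := add_le_add h1 (by rw [norm_sub_rev]; exact hcoarse)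
      _ = 37 * B₂' * latLen r ^ 2 := by rw [hℓ]; ring
  -- total
  have hgoal : S.blockSpinLog r a ⟨b, μ⟩ - ∫ t in (0 : ℝ)..latLen r, A (q + t • unitVec μ) μ
      = (S.FL X - ∫ t in (0 : ℝ)..latLen r, A (q + t • unitVec μ) μ) + S.Fprime X := by
    rw [hsplit]; abel
  show ‖S.blockSpinLog r a ⟨b, μ⟩ - ∫ t in (0 : ℝ)..latLen r, A (q + t • unitVec μ) μ‖ ≤ _
  rw [hgoal]
  calc ‖(S.FL X - ∫ t in (0 : ℝ)..latLen r, A (q + t • unitVec μ) μ) + S.Fprime X‖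
      ≤ ‖S.FL X - ∫ t in (0 : ℝ)..latLen r, A (q + t • unitVec μ) μ‖ + ‖S.Fprime X‖ := norm_add_le _ _
    _ ≤ 37 * B₂' * latLen r ^ 2 + max c₀ 0 / 4 * B₁' ^ 2 * latLen r ^ 2 := add_le_add hFLerr hF'
    _ = (37 * B₂' + max c₀ 0 / 4 * B₁' ^ 2) * latLen r ^ 2 := by ring

/-! ## §2 The cascade against the coarse line integrals: telescoping over the runs with (31) -/

/-- **The level-`s` variable of the logarithmic cascade from the data (7) at level `r` differs from the level-`s` datum by
`≤ K₃(B₂′ + B₁′²)ℓ_s²`, uniformly in `r ≥ s`** — «the A(e, r₀) converge with better bounds» in homogeneous form: `K₃` a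
scheme constant, the threshold from the caps `B₁, B₂`, the bound linear in the potential's own `B₂′` and `B₁′²`
(telescoping over the runs `r = s, s+1, …`, each consecutive pair controlled by the top step `topStep_of_le` propagated down
by (31)). [cite: Federbush1987PhaseCellVI, (28) p. 22, (29)–(31) p. 23, (11)–(12) p. 20] -/
theorem norm_iterBlockSpinLog_logData_sub_logData_le_of_le (hFS : S.IsFederbushSystem) :
    ∃ K₃ : ℝ, 0 ≤ K₃ ∧ ∀ B₁ B₂ : ℝ, 0 ≤ B₁ → 0 ≤ B₂ → ∃ s₃ : ℕ, ∀ (A : S.Potential), ContDiff ℝ 1 A →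
      ∀ (B₁' B₂' : ℝ), (∀ x μ, ‖A x μ‖ ≤ B₁') → (∀ x μ ν, ‖fderiv ℝ (fun y => A y μ) x (unitVec ν)‖ ≤ B₂') →
        B₁' ≤ B₁ → B₂' ≤ B₂ → ∀ (r s : ℕ), s₃ < s → s ≤ r → ∀ e : Edge s,
          ‖S.iterBlockSpinLog s r (S.logData A r) e - S.logData A s e‖ ≤ K₃ * (B₂' + B₁' ^ 2) * latLen s ^ 2 := by
  obtain ⟨K, hK, HT⟩ := S.topStep_of_le hFS
  obtain ⟨c, H31⟩ := S.eq31 hFS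
  set C'' : ℝ := max (max c 0) 1 with hC''def
  have hC''1 : 1 ≤ C'' := le_max_right _ _
  have hC''c : c ≤ C'' := (le_max_left _ _).trans (le_max_left _ _)
  have hC''0 : 0 ≤ C'' := zero_le_one.trans hC''1
  refine ⟨4 * C'' * max 37 K, by positivity, fun B₁ B₂ hB₁ hB₂ => ?_⟩
  obtain ⟨rbar, HT'⟩ := HT B₁ hB₁
  set ctop : ℝ := 37 * B₂ + K * B₁ ^ 2 with hctopdef
  have hctop0 : 0 ≤ ctop := by positivity
  set a : ℝ := B₁ + ctop + 2 with hadef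
  have ha0 : 0 < a := by positivity
  obtain ⟨s₀, H31'⟩ := H31 a ha0
  refine ⟨max rbar s₀, ?_⟩
  intro A hA B₁' B₂' hB₁' hB₂' h₁ h₂ r s hs hsr e
  have hB₁'0 : 0 ≤ B₁' := (norm_nonneg _).trans (hB₁' 0 0)
  have hB₂'0 : 0 ≤ B₂' := (norm_nonneg _).trans (hB₂' 0 0 0)
  have hrbar : rbar ≤ s := ((le_max_left _ _).trans hs.le)
  have hs₀ : s₀ < s := lt_of_le_of_lt (le_max_right _ _) hs
  set ct : ℝ := 37 * B₂' + K * B₁' ^ 2 with hctdef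
  have hct0 : 0 ≤ ct := by positivity
  have hctle : ct ≤ ctop := by
    rw [hctdef, hctopdef]
    have : B₁' ^ 2 ≤ B₁ ^ 2 := pow_le_pow_left₀ hB₁'0 h₁ 2
    nlinarith
  have hℓs := latLen_pos s
  -- the top step at every level ≥ s, for this potential
  have htop : ∀ (j : ℕ), s ≤ j → ∀ f : Edge j,
      ‖S.blockSpinLog j (S.logData A (j + 1)) f - S.logData A j f‖ ≤ ct * latLen j ^ 2 :=
    fun j hj f => HT' A hA B₁' B₂' hB₁' hB₂' h₁ j (hrbar.trans hj) f
  -- one term of the telescope, propagated down by (31)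
  have hstep : ∀ n : ℕ, 0 < n →
      ‖S.iterBlockSpinLog s (s + n) (S.blockSpinLog (s + n) (S.logData A (s + n + 1))) e -
          S.iterBlockSpinLog s (s + n) (S.logData A (s + n)) e‖ ≤ 2 * C'' * ct * latLen s * latLen (s + n) := by
    intro n hn
    have hℓn := latLen_pos (s + n)
    have hℓn1 : latLen (s + n) ≤ 1 := latLen_le_one _
    have hsz₂ : ∀ f : Edge (s + n), ‖S.logData A (s + n) f‖ ≤ latLen (s + n) * a := fun f =>
      (S.norm_logData_le A hB₁' f).trans (by rw [hadef]; nlinarith)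
    have hsz₁ : ∀ f : Edge (s + n), ‖S.blockSpinLog (s + n) (S.logData A (s + n + 1)) f‖ ≤ latLen (s + n) * a := by
      intro f
      have h1 := htop (s + n) (by omega) f
      have h2 := S.norm_logData_le A hB₁' f
      have h3 : ‖S.blockSpinLog (s + n) (S.logData A (s + n + 1)) f‖ ≤ ct * latLen (s + n) ^ 2 + latLen (s + n) * B₁' := by
        calc _ ≤ ‖S.blockSpinLog (s + n) (S.logData A (s + n + 1)) f - S.logData A (s + n) f‖ + ‖S.logData A (s + n) f‖ :=
              norm_le_norm_sub_add _ _
          _ ≤ _ := add_le_add h1 h2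
      have h4 : ct * latLen (s + n) ^ 2 + latLen (s + n) * B₁' ≤ latLen (s + n) * a := by
        rw [hadef]
        have : ct * latLen (s + n) ^ 2 ≤ ctop * latLen (s + n) := by
          calc ct * latLen (s + n) ^ 2 ≤ ctop * latLen (s + n) ^ 2 := mul_le_mul_of_nonneg_right hctle (sq_nonneg _)
            _ ≤ ctop * latLen (s + n) := by
                apply mul_le_mul_of_nonneg_left _ hctop0
                nlinarith
        nlinarith
      exact h3.trans h4
    have main : ∀ η : ℝ, 0 < η → η < 1 →
        ‖S.iterBlockSpinLog s (s + n) (S.blockSpinLog (s + n) (S.logData A (s + n + 1))) e -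
            S.iterBlockSpinLog s (s + n) (S.logData A (s + n)) e‖ ≤ 2 * C'' * latLen s * latLen (s + n) * (ct + η) := by
      intro η hη hη1
      set b : ℝ := (ct + η) * latLen (s + n) / a with hbdef
      have hb0 : 0 < b := by positivity
      have hb1 : b < 1 := by
        rw [hbdef, div_lt_one ha0, hadef]
        have : (ct + η) * latLen (s + n) ≤ (ctop + 1) * 1 :=
          mul_le_mul (by linarith) hℓn1 hℓn.le (by positivity)
        linarith
      have hdiff : ∀ f : Edge (s + n), ‖S.blockSpinLog (s + n) (S.logData A (s + n + 1)) f - S.logData A (s + n) f‖ ≤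
          latLen (s + n) * b * a := by
        intro f
        refine (htop (s + n) (by omega) f).trans ?_
        rw [hbdef]
        field_simp
        nlinarith [sq_nonneg (latLen (s + n)), mul_nonneg hη.le (sq_nonneg (latLen (s + n)))]
      have h31 := H31' b hb0 hb1 (s + n) _ _ hsz₁ hsz₂ hdiff s hs₀ (by omega) e
      calc _ ≤ 2 * c * latLen s * b * a := h31
        _ ≤ 2 * C'' * latLen s * b * a := by
            have : 0 ≤ latLen s * b * a := by positivity
            nlinarith
        _ = 2 * C'' * latLen s * latLen (s + n) * (ct + η) := by rw [hbdef]; field_simp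
    have := le_of_forall_eta' (c := 2 * C'' * latLen s * latLen (s + n)) (B := ct) (by positivity) main
    calc _ ≤ 2 * C'' * latLen s * latLen (s + n) * ct := this
      _ = 2 * C'' * ct * latLen s * latLen (s + n) := by ring
  -- the telescope: induction on the run length
  obtain ⟨n, rfl⟩ : ∃ n, r = s + n := ⟨r - s, by omega⟩
  have tele : ∀ m : ℕ, ‖S.iterBlockSpinLog s (s + m) (S.logData A (s + m)) e - S.logData A s e‖ ≤
      2 * C'' * ct * latLen s * (2 * (latLen s - latLen (s + m))) := by
    intro m
    induction m with
    | zero =>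
      show ‖S.iterBlockSpinLog s s (S.logData A s) e - S.logData A s e‖ ≤
        2 * C'' * ct * latLen s * (2 * (latLen s - latLen s))
      rw [S.iterBlockSpinLog_self, sub_self, norm_zero, sub_self, mul_zero, mul_zero]
    | succ m ih =>
      show ‖S.iterBlockSpinLog s (s + m + 1) (S.logData A (s + m + 1)) e - S.logData A s e‖ ≤
        2 * C'' * ct * latLen s * (2 * (latLen s - latLen (s + m + 1)))
      rw [S.iterBlockSpinLog_top s (s + m) (by omega)]
      have hone : ‖S.iterBlockSpinLog s (s + m) (S.blockSpinLog (s + m) (S.logData A (s + m + 1))) e -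
          S.iterBlockSpinLog s (s + m) (S.logData A (s + m)) e‖ ≤ 2 * C'' * ct * latLen s * latLen (s + m) := by
        rcases Nat.eq_zero_or_pos m with hm | hm
        · subst hm
          show ‖S.iterBlockSpinLog s s (S.blockSpinLog s (S.logData A (s + 1))) e -
              S.iterBlockSpinLog s s (S.logData A s) e‖ ≤ 2 * C'' * ct * latLen s * latLen s
          rw [S.iterBlockSpinLog_self, S.iterBlockSpinLog_self]
          calc _ ≤ ct * latLen s ^ 2 := htop s le_rfl e
            _ ≤ 2 * C'' * ct * latLen s * latLen s := by
                rw [sq, ← mul_assoc]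
                have : 0 ≤ ct * latLen s * latLen s := by positivity
                nlinarith
        · exact hstep m hm
      have hsucc : latLen (s + m + 1) = latLen (s + m) / 2 := latLen_succ _
      calc ‖S.iterBlockSpinLog s (s + m) (S.blockSpinLog (s + m) (S.logData A (s + m + 1))) e - S.logData A s e‖
          ≤ ‖S.iterBlockSpinLog s (s + m) (S.blockSpinLog (s + m) (S.logData A (s + m + 1))) e -
                S.iterBlockSpinLog s (s + m) (S.logData A (s + m)) e‖ +
              ‖S.iterBlockSpinLog s (s + m) (S.logData A (s + m)) e - S.logData A s e‖ :=
            norm_sub_le_norm_sub_add_norm_sub _ _ _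
        _ ≤ 2 * C'' * ct * latLen s * latLen (s + m) + 2 * C'' * ct * latLen s * (2 * (latLen s - latLen (s + m))) :=
            add_le_add hone ih
        _ = 2 * C'' * ct * latLen s * (2 * (latLen s - latLen (s + m + 1))) := by rw [hsucc]; ring
  have hfin := tele n
  have hct' : ct ≤ max 37 K * (B₂' + B₁' ^ 2) := by
    rw [hctdef, mul_add]
    exact add_le_add (mul_le_mul_of_nonneg_right (le_max_left _ _) hB₂'0)
      (mul_le_mul_of_nonneg_right (le_max_right _ _) (sq_nonneg _))
  calc _ ≤ 2 * C'' * ct * latLen s * (2 * (latLen s - latLen (s + n))) := hfin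
    _ ≤ 2 * C'' * ct * latLen s * (2 * latLen s) := by
        apply mul_le_mul_of_nonneg_left _ (by positivity)
        linarith [latLen_pos (s + n)]
    _ = 4 * C'' * ct * latLen s ^ 2 := by ring
    _ ≤ 4 * C'' * (max 37 K * (B₂' + B₁' ^ 2)) * latLen s ^ 2 := by
        apply mul_le_mul_of_nonneg_right _ (sq_nonneg _)
        exact mul_le_mul_of_nonneg_left hct' (by positivity)
    _ = 4 * C'' * max 37 K * (B₂' + B₁' ^ 2) * latLen s ^ 2 := by ring

/-! ## §3 The line integral (7) against the point value at the source -/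

/-- `|λ_s(e) − ℓ_s A_μ(x_e)| ≤ 2B₂′ℓ_s²` for a `C¹` potential with axis derivatives `≤ B₂′` (Taylor along the edge).
[cite: Federbush1987PhaseCellVI, (7) p. 19; Federbush1986PhaseCellI, (2.10) p. 326] -/
theorem norm_logData_sub_smul_le (A : S.Potential) (hA : ContDiff ℝ 1 A) {B₂' : ℝ}
    (hB₂' : ∀ x μ ν, ‖fderiv ℝ (fun y => A y μ) x (unitVec ν)‖ ≤ B₂') {s : ℕ} (e : Edge s) :
    ‖S.logData A s e - latLen s • A e.src e.dir‖ ≤ 2 * B₂' * latLen s ^ 2 := by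
  have hB₂'0 : 0 ≤ B₂' := (norm_nonneg _).trans (hB₂' 0 0 0)
  have hℓ := latLen_pos s
  unfold logData
  have h := S.norm_lineInt_sub_smul_le A hA e.src e.dir (A e.src e.dir) hℓ.le (K := 2 * B₂' * latLen s)
    fun t ht => by
      calc ‖A (e.src + t • unitVec e.dir) e.dir - A e.src e.dir‖ ≤ 2 * B₂' * ‖e.src + t • unitVec e.dir - e.src‖ :=
            S.norm_sub_le_of_fderiv_le A hA hB₂' e.dir e.src _
        _ ≤ 2 * B₂' * latLen s := by
            apply mul_le_mul_of_nonneg_left _ (by positivity)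
            have hu : ‖unitVec e.dir‖ = 1 := by simp [unitVec]
            rw [add_sub_cancel_left, norm_smul, hu, mul_one, Real.norm_of_nonneg ht.1]
            exact ht.2
  calc _ ≤ latLen s * (2 * B₂' * latLen s) := h
    _ = 2 * B₂' * latLen s ^ 2 := by ring

/-- **The edge variables of the cascade against the potential**: `|A(e; s)[r] − ℓ_s A_μ(x_e)| ≤ K(B₂′ + B₁′²)ℓ_s²` uniformly
in the run length `r ≥ s > s₃`, `K` a scheme constant, the threshold from the caps. [cite: Federbush1987PhaseCellVI, (28)
p. 22, (29)–(31) p. 23, (7) p. 19; Federbush1986PhaseCellI, (2.10) p. 326] -/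
theorem norm_iterBlockSpinLog_logData_sub_smul_le_of_le (hFS : S.IsFederbushSystem) :
    ∃ K : ℝ, 0 ≤ K ∧ ∀ B₁ B₂ : ℝ, 0 ≤ B₁ → 0 ≤ B₂ → ∃ s₃ : ℕ, ∀ (A : S.Potential), ContDiff ℝ 1 A →
      ∀ (B₁' B₂' : ℝ), (∀ x μ, ‖A x μ‖ ≤ B₁') → (∀ x μ ν, ‖fderiv ℝ (fun y => A y μ) x (unitVec ν)‖ ≤ B₂') →
        B₁' ≤ B₁ → B₂' ≤ B₂ → ∀ (r s : ℕ), s₃ < s → s ≤ r → ∀ e : Edge s,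
          ‖S.iterBlockSpinLog s r (S.logData A r) e - latLen s • A e.src e.dir‖ ≤ K * (B₂' + B₁' ^ 2) * latLen s ^ 2 := by
  obtain ⟨K₃, hK₃, H⟩ := S.norm_iterBlockSpinLog_logData_sub_logData_le_of_le hFS
  refine ⟨K₃ + 2, by positivity, fun B₁ B₂ hB₁ hB₂ => ?_⟩
  obtain ⟨s₃, H'⟩ := H B₁ B₂ hB₁ hB₂
  refine ⟨s₃, fun A hA B₁' B₂' hB₁' hB₂' h₁ h₂ r s hs hsr e => ?_⟩
  have hB₁'0 : 0 ≤ B₁' := (norm_nonneg _).trans (hB₁' 0 0)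
  have hB₂'0 : 0 ≤ B₂' := (norm_nonneg _).trans (hB₂' 0 0 0)
  calc _ ≤ ‖S.iterBlockSpinLog s r (S.logData A r) e - S.logData A s e‖ + ‖S.logData A s e - latLen s • A e.src e.dir‖ :=
        norm_sub_le_norm_sub_add_norm_sub _ _ _
    _ ≤ K₃ * (B₂' + B₁' ^ 2) * latLen s ^ 2 + 2 * B₂' * latLen s ^ 2 :=
        add_le_add (H' A hA B₁' B₂' hB₁' hB₂' h₁ h₂ r s hs hsr e) (S.norm_logData_sub_smul_le A hA hB₂' e)
    _ ≤ (K₃ + 2) * (B₂' + B₁' ^ 2) * latLen s ^ 2 := by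
        have : 0 ≤ B₁' ^ 2 * latLen s ^ 2 := by positivity
        nlinarith

end BlockSpinSystem

end

end Literature.MathematicalPhysics.QuantumFieldTheory.Federbush1986
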